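import Mathlib
import Summits.ValiantsHypothesis.ValiantsHypothesis.Theorems.NewtonUnitEquationsNewtonTauWeakSumsetChartCount

/-!
# `NewtonUnitEquationsNewtonTauWeakFourCoreSplitting` — four cores give base three: `A(4,x) + 2^x ≤ 2·3^x`

Line `binomial-normal-form` of crux `NewtonTauWeak` (stmt-ValiantsHypothesis-5904), lead c7, rung C7b, stub P6: the
MINKOWSKI SPLITTING THEOREM at `c = 4 = 2 + 2`.  A four-core DESIGN is `h : Fin 4 → Finset (Fin x) → ℕ²`; a
configuration `f : Fin x → Fin 4` (attached element `u` joins core `f u`) has the point `P f = Σ_d h d (f⁻¹ d)`, and the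
stub bounds the number of STRICTLY POSITIVELY EXPOSED points of the cloud `{P f}` (unique minimisers of a linear form
with positive weights `w₀, w₁`) by `2·3^x − 2^x`.

Proof.  Condition on `W = f⁻¹{2,3}`.  The configurations with a given `W` are the product of the `{0,1}`-configurations
on `Wᶜ` (coded by `S = f⁻¹ 1 ⊆ Wᶜ`) and the `{2,3}`-configurations on `W` (coded by `S' = f⁻¹ 3 ⊆ W`), and their
points form the planar sumset `A_W ⊕ B_W` of `A_W = {h 0 (Wᶜ \ S) + h 1 S : S ⊆ Wᶜ}` and
`B_W = {h 2 (W \ S') + h 3 S' : S' ⊆ W}` (`sum_fibre_eq` slices, `sum_glue` glues back).  A point exposed by `w` in the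
whole cloud is the unique maximiser over its own slice of the height `t·q₀ − q₁`, `t = −w₀/w₁` (`chart_of_exposed`),
i.e. a chart point of `A_W ⊕ B_W` for the chart `σ = −1`; by the chart lemma for planar Minkowski sums (the landed brick
`stub_sumsetChartCount`) a slice has at most `|A_W| + |B_W| − 1 ≤ 2^{x−|W|} + 2^{|W|} − 1` chart points
(`chart_ncard_sumset_lt`), and `Σ_W 2^{|W|} = Σ_W 2^{x−|W|} = 3^x` (binomial theorem), `Σ_W 1 = 2^x`.  Everything is
kept in `ℕ` in the shape `· + 1 ≤ ·` (no truncated subtraction).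

`stub_fourCoreSplitting` is the registered stub text, verbatim.  Folklore-level; Mathlib and the landed brick
`stub_sumsetChartCount` only; no citations, no `def`s.
-/

-- Sub = Summit single-conjunct layout: the duplicated namespace component is mandated by the tree.
set_option linter.dupNamespace false

open scoped BigOperators

namespace Summit.ValiantsHypothesis.ValiantsHypothesis.Theorems.NewtonUnitEquationsNewtonTauWeak

namespace FourCoreSplittingAux

/-- GLUING: the configuration glued from `S ⊆ Wᶜ` (core `1`), `Wᶜ \ S` (core `0`), `S' ⊆ W` (core `3`) and `W \ S'`
(core `2`) has the point `(h 0 (Wᶜ \ S) + h 1 S) + (h 2 (W \ S') + h 3 S')`. [folklore] -/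
theorem sum_glue {x : ℕ} (h : Fin 4 → Finset (Fin x) → (Fin 2 →₀ ℕ)) (W S S' : Finset (Fin x)) (hS : S ⊆ Wᶜ)
    (hS' : S' ⊆ W) (g : Fin x → Fin 4)
    (hg : ∀ u, g u = if u ∈ W then (if u ∈ S' then 3 else 2) else (if u ∈ S then 1 else 0)) :
    ∑ d, h d (Finset.univ.filter fun u => g u = d) = (h 0 (Wᶜ \ S) + h 1 S) + (h 2 (W \ S') + h 3 S') := by
  have hSW : ∀ u, u ∈ S → u ∉ W := fun u hu => Finset.mem_compl.mp (hS hu)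
  have hS'W : ∀ u, u ∈ S' → u ∈ W := fun u hu => hS' hu
  obtain ⟨h0, h1, h2, h3⟩ : (Finset.univ.filter fun u => g u = 0) = Wᶜ \ S ∧
      (Finset.univ.filter fun u => g u = 1) = S ∧ (Finset.univ.filter fun u => g u = 2) = W \ S' ∧
      (Finset.univ.filter fun u => g u = 3) = S' := by
    refine ⟨?_, ?_, ?_, ?_⟩ <;> ext u <;>
      simp only [Finset.mem_filter, Finset.mem_univ, true_and, Finset.mem_sdiff, Finset.mem_compl, hg u] <;>
      specialize hSW u <;> specialize hS'W u <;>
      by_cases hu : u ∈ W <;> by_cases hu1 : u ∈ S <;> by_cases hu3 : u ∈ S' <;> simp_all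
  rw [Fin.sum_univ_four, h0, h1, h2, h3, add_assoc]

/-- SLICING: along `W = f⁻¹{2,3}` the point of a configuration `f` is the sum of an `A_W`-summand (coded by
`S = f⁻¹ 1`) and a `B_W`-summand (coded by `S' = f⁻¹ 3`). [folklore] -/
theorem sum_fibre_eq {x : ℕ} (h : Fin 4 → Finset (Fin x) → (Fin 2 →₀ ℕ)) (f : Fin x → Fin 4) (W : Finset (Fin x))
    (hW : W = Finset.univ.filter fun u => f u = 2 ∨ f u = 3) :
    ∑ d, h d (Finset.univ.filter fun u => f u = d) =
      (h 0 (Wᶜ \ (Finset.univ.filter fun u => f u = 1)) + h 1 (Finset.univ.filter fun u => f u = 1)) +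
        (h 2 (W \ (Finset.univ.filter fun u => f u = 3)) + h 3 (Finset.univ.filter fun u => f u = 3)) := by
  have h0 : Wᶜ \ (Finset.univ.filter fun u => f u = 1) = Finset.univ.filter fun u => f u = 0 := by
    ext u
    simp only [hW, Finset.mem_sdiff, Finset.mem_compl, Finset.mem_filter, Finset.mem_univ, true_and]
    have key : ∀ a : Fin 4, ¬(a = 2 ∨ a = 3) ∧ ¬a = 1 ↔ a = 0 := by decide
    exact key (f u)
  have h2 : W \ (Finset.univ.filter fun u => f u = 3) = Finset.univ.filter fun u => f u = 2 := by
    ext u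
    simp only [hW, Finset.mem_sdiff, Finset.mem_filter, Finset.mem_univ, true_and]
    have key : ∀ a : Fin 4, (a = 2 ∨ a = 3) ∧ ¬a = 3 ↔ a = 2 := by decide
    exact key (f u)
  rw [Fin.sum_univ_four, h0, h2, add_assoc]

/-- `f⁻¹ 1 ⊆ Wᶜ` for `W = f⁻¹{2,3}`. [folklore] -/
theorem filter_one_subset {x : ℕ} (f : Fin x → Fin 4) (W : Finset (Fin x))
    (hW : W = Finset.univ.filter fun u => f u = 2 ∨ f u = 3) : (Finset.univ.filter fun u => f u = 1) ⊆ Wᶜ := by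
  intro u hu
  simp only [Finset.mem_filter, Finset.mem_univ, true_and] at hu
  simp only [hW, Finset.mem_compl, Finset.mem_filter, Finset.mem_univ, true_and, hu]
  decide

/-- `f⁻¹ 3 ⊆ W` for `W = f⁻¹{2,3}`. [folklore] -/
theorem filter_three_subset {x : ℕ} (f : Fin x → Fin 4) (W : Finset (Fin x))
    (hW : W = Finset.univ.filter fun u => f u = 2 ∨ f u = 3) : (Finset.univ.filter fun u => f u = 3) ⊆ W := by
  intro u hu
  simp only [Finset.mem_filter, Finset.mem_univ, true_and] at hu
  simp only [hW, Finset.mem_filter, Finset.mem_univ, true_and, hu]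
  decide

/-- SLICE MEMBERSHIP: the point of `f` lies in the sumset `A_W ⊕ B_W` of its own slice `W = f⁻¹{2,3}`. [folklore] -/
theorem sum_fibre_mem {x : ℕ} (h : Fin 4 → Finset (Fin x) → (Fin 2 →₀ ℕ)) (f : Fin x → Fin 4) (W : Finset (Fin x))
    (hW : W = Finset.univ.filter fun u => f u = 2 ∨ f u = 3) (A B : Finset (Fin 2 →₀ ℕ))
    (hA : A = (Wᶜ).powerset.image fun S => h 0 (Wᶜ \ S) + h 1 S)
    (hB : B = W.powerset.image fun S => h 2 (W \ S) + h 3 S) :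
    ∑ d, h d (Finset.univ.filter fun u => f u = d) ∈
      (A ×ˢ B).image (fun pq : (Fin 2 →₀ ℕ) × (Fin 2 →₀ ℕ) => pq.1 + pq.2) := by
  rw [sum_fibre_eq h f W hW, hA, hB]
  exact SumsetChartCountAux.add_mem_sumset
    (Finset.mem_image_of_mem _ (Finset.mem_powerset.mpr (filter_one_subset f W hW)))
    (Finset.mem_image_of_mem _ (Finset.mem_powerset.mpr (filter_three_subset f W hW)))

/-- GLUING BACK: every point of the sumset `A_W ⊕ B_W` is the point of a configuration. [folklore] -/
theorem exists_conf_of_mem {x : ℕ} (h : Fin 4 → Finset (Fin x) → (Fin 2 →₀ ℕ)) (W : Finset (Fin x))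
    (A B : Finset (Fin 2 →₀ ℕ)) (hA : A = (Wᶜ).powerset.image fun S => h 0 (Wᶜ \ S) + h 1 S)
    (hB : B = W.powerset.image fun S => h 2 (W \ S) + h 3 S) (p : Fin 2 →₀ ℕ)
    (hp : p ∈ (A ×ˢ B).image (fun pq : (Fin 2 →₀ ℕ) × (Fin 2 →₀ ℕ) => pq.1 + pq.2)) :
    ∃ g : Fin x → Fin 4, ∑ d, h d (Finset.univ.filter fun u => g u = d) = p := by
  subst hA hB
  obtain ⟨a, ha, b, hb, rfl⟩ := SumsetChartCountAux.mem_sumset_iff.mp hp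
  obtain ⟨S, hS, rfl⟩ := Finset.mem_image.mp ha
  obtain ⟨S', hS', rfl⟩ := Finset.mem_image.mp hb
  exact ⟨fun u => if u ∈ W then (if u ∈ S' then 3 else 2) else (if u ∈ S then 1 else 0),
    sum_glue h W S S' (Finset.mem_powerset.mp hS) (Finset.mem_powerset.mp hS') _ fun _ => rfl⟩

/-- CHANGE OF CHART: strict exposure by positive weights `(w₀, w₁)` is unique maximality of the height `t·q₀ − q₁`
with `t = −w₀/w₁`. [folklore] -/
theorem chart_of_exposed {w₀ w₁ a b c d : ℝ} (hw₁ : 0 < w₁) (hlt : w₀ * a + w₁ * b < w₀ * c + w₁ * d) :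
    -(w₀ / w₁) * c + (-1) * d < -(w₀ / w₁) * a + (-1) * b := by
  have key : (w₀ / w₁) * a + b < (w₀ / w₁) * c + d := by
    have e1 : w₁ * ((w₀ / w₁) * a + b) = w₀ * a + w₁ * b := by
      rw [mul_add, ← mul_assoc, mul_div_cancel₀ _ hw₁.ne']
    have e2 : w₁ * ((w₀ / w₁) * c + d) = w₀ * c + w₁ * d := by
      rw [mul_add, ← mul_assoc, mul_div_cancel₀ _ hw₁.ne']
    exact lt_of_mul_lt_mul_left (e1.symm ▸ e2.symm ▸ hlt) hw₁.le
  linarith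

/-- PER-SLICE COUNT: a planar sumset `A ⊕ B` of nonempty finite sets has fewer than `|A| + |B|` chart points for the
chart `σ = −1` — the landed brick `stub_sumsetChartCount` followed by `U(A) ⊆ A`, `U(B) ⊆ B`. [folklore] -/
theorem chart_ncard_sumset_lt (A B : Finset (Fin 2 →₀ ℕ)) (hA : A.Nonempty) (hB : B.Nonempty) :
    {p : Fin 2 →₀ ℕ | p ∈ (A ×ˢ B).image (fun pq : (Fin 2 →₀ ℕ) × (Fin 2 →₀ ℕ) => pq.1 + pq.2) ∧
        ∃ t : ℝ, ∀ q ∈ (A ×ˢ B).image (fun pq : (Fin 2 →₀ ℕ) × (Fin 2 →₀ ℕ) => pq.1 + pq.2), q ≠ p →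
          t * ((q 0 : ℕ) : ℝ) + (-1) * ((q 1 : ℕ) : ℝ) < t * ((p 0 : ℕ) : ℝ) + (-1) * ((p 1 : ℕ) : ℝ)}.ncard + 1 ≤
      A.card + B.card := by
  refine (stub_sumsetChartCount (-1) (by norm_num) A B hA hB).trans (add_le_add ?_ ?_)
  · calc {p : Fin 2 →₀ ℕ | p ∈ A ∧ ∃ t : ℝ, ∀ q ∈ A, q ≠ p →
          t * ((q 0 : ℕ) : ℝ) + (-1) * ((q 1 : ℕ) : ℝ) < t * ((p 0 : ℕ) : ℝ) + (-1) * ((p 1 : ℕ) : ℝ)}.ncard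
        ≤ (A : Set (Fin 2 →₀ ℕ)).ncard := Set.ncard_le_ncard (fun p hp => hp.1) A.finite_toSet
      _ = A.card := Set.ncard_coe_finset A
  · calc {p : Fin 2 →₀ ℕ | p ∈ B ∧ ∃ t : ℝ, ∀ q ∈ B, q ≠ p →
          t * ((q 0 : ℕ) : ℝ) + (-1) * ((q 1 : ℕ) : ℝ) < t * ((p 0 : ℕ) : ℝ) + (-1) * ((p 1 : ℕ) : ℝ)}.ncard
        ≤ (B : Set (Fin 2 →₀ ℕ)).ncard := Set.ncard_le_ncard (fun p hp => hp.1) B.finite_toSet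
      _ = B.card := Set.ncard_coe_finset B

/-- `Σ_{W ⊆ [x]} 2^{|W|} = 3^x` (binomial theorem). [folklore] -/
theorem sum_two_pow_card (x : ℕ) : ∑ W : Finset (Fin x), (2 : ℕ) ^ W.card = 3 ^ x := by
  simpa using Fin.sum_pow_mul_eq_add_pow (2 : ℕ) 1 (n := x)

/-- `Σ_{W ⊆ [x]} 2^{x − |W|} = 3^x` (binomial theorem). [folklore] -/
theorem sum_two_pow_sub_card (x : ℕ) : ∑ W : Finset (Fin x), (2 : ℕ) ^ (x - W.card) = 3 ^ x := by
  simpa [add_comm] using Fin.sum_pow_mul_eq_add_pow (1 : ℕ) 2 (n := x)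

/-- `Σ_{W ⊆ [x]} 1 = 2^x`. [folklore] -/
theorem sum_one_eq (x : ℕ) : ∑ _W : Finset (Fin x), (1 : ℕ) = 2 ^ x := by
  simp [Fintype.card_finset]

end FourCoreSplittingAux

open FourCoreSplittingAux

/-- **STUB P6 `stub_fourCoreSplitting`** (registered signature, verbatim) — the four-core splitting bound
`A(4,x) + 2^x ≤ 2·3^x` in design language: the strictly positively exposed points of the cloud of a four-core design
number at most `2·3^x − 2^x`.  Minkowski splitting along `W = f⁻¹{2,3}` and the chart lemma for planar sumsets.
[folklore] -/
theorem stub_fourCoreSplitting (x : ℕ) (h : Fin 4 → Finset (Fin x) → (Fin 2 →₀ ℕ)) :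
    {q : Fin 2 →₀ ℕ | ∃ f : Fin x → Fin 4, ∑ d, h d (Finset.univ.filter fun u => f u = d) = q ∧
        ∃ w : Fin 2 → ℝ, 0 < w 0 ∧ 0 < w 1 ∧ ∀ f' : Fin x → Fin 4,
          ∑ d, h d (Finset.univ.filter fun u => f' u = d) ≠ q →
          w 0 * ((q 0 : ℕ) : ℝ) + w 1 * ((q 1 : ℕ) : ℝ) <
            w 0 * (((∑ d, h d (Finset.univ.filter fun u => f' u = d)) 0 : ℕ) : ℝ) +
              w 1 * (((∑ d, h d (Finset.univ.filter fun u => f' u = d)) 1 : ℕ) : ℝ)}.ncard + 2 ^ x ≤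
      2 * 3 ^ x := by
  -- the two factor clouds `A_W`, `B_W` and the chart set `U_W` of the slice `W`
  obtain ⟨A, hA⟩ : ∃ A : Finset (Fin x) → Finset (Fin 2 →₀ ℕ),
      ∀ W, A W = (Wᶜ).powerset.image fun S => h 0 (Wᶜ \ S) + h 1 S := ⟨_, fun _ => rfl⟩
  obtain ⟨B, hB⟩ : ∃ B : Finset (Fin x) → Finset (Fin 2 →₀ ℕ),
      ∀ W, B W = W.powerset.image fun S => h 2 (W \ S) + h 3 S := ⟨_, fun _ => rfl⟩
  obtain ⟨U, hU⟩ : ∃ U : Finset (Fin x) → Set (Fin 2 →₀ ℕ), ∀ W, U W =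
      {p : Fin 2 →₀ ℕ | p ∈ (A W ×ˢ B W).image (fun pq : (Fin 2 →₀ ℕ) × (Fin 2 →₀ ℕ) => pq.1 + pq.2) ∧
        ∃ t : ℝ, ∀ q ∈ (A W ×ˢ B W).image (fun pq : (Fin 2 →₀ ℕ) × (Fin 2 →₀ ℕ) => pq.1 + pq.2), q ≠ p →
          t * ((q 0 : ℕ) : ℝ) + (-1) * ((q 1 : ℕ) : ℝ) < t * ((p 0 : ℕ) : ℝ) + (-1) * ((p 1 : ℕ) : ℝ)} :=
    ⟨_, fun _ => rfl⟩
  -- (iv) per-slice bound `|U_W| + 1 ≤ |A_W| + |B_W| ≤ 2^{x−|W|} + 2^{|W|}`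
  have hslice : ∀ W, (U W).ncard + 1 ≤ 2 ^ (x - W.card) + 2 ^ W.card := by
    intro W
    have hAne : (A W).Nonempty := by rw [hA]; exact (Finset.powerset_nonempty _).image _
    have hBne : (B W).Nonempty := by rw [hB]; exact (Finset.powerset_nonempty _).image _
    rw [hU]
    refine (chart_ncard_sumset_lt (A W) (B W) hAne hBne).trans (add_le_add ?_ ?_)
    · rw [hA]
      refine Finset.card_image_le.trans ?_
      rw [Finset.card_powerset, Finset.card_compl, Fintype.card_fin]
    · rw [hB]
      refine Finset.card_image_le.trans ?_
      rw [Finset.card_powerset]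
  -- each chart set is finite
  have hfin : ∀ W, (U W).Finite := fun W => by
    rw [hU]
    exact (Finset.finite_toSet _).subset fun p hp => hp.1
  -- (iii) + (v): counting over the `2^x` slices
  have key : ∀ E : Set (Fin 2 →₀ ℕ), E ⊆ ⋃ W, U W → E.ncard + 2 ^ x ≤ 2 * 3 ^ x := by
    intro E hE
    have h1 : E.ncard ≤ ∑ W, (U W).ncard :=
      (Set.ncard_le_ncard hE (Set.finite_iUnion hfin)).trans (Set.ncard_iUnion_le_of_fintype U)
    have h2 : ∑ W : Finset (Fin x), ((U W).ncard + 1) ≤ ∑ W : Finset (Fin x), (2 ^ (x - W.card) + 2 ^ W.card) :=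
      Finset.sum_le_sum fun W _ => hslice W
    rw [Finset.sum_add_distrib, Finset.sum_add_distrib, sum_two_pow_sub_card, sum_two_pow_card, sum_one_eq] at h2
    omega
  refine key _ ?_
  -- (i) + (ii): a strictly positively exposed point is a chart point of its own slice `W = f⁻¹{2,3}`
  rintro q ⟨f, rfl, w, -, hw1, hmin⟩
  refine Set.mem_iUnion.mpr ⟨Finset.univ.filter fun u => f u = 2 ∨ f u = 3, ?_⟩
  rw [hU, Set.mem_setOf_eq]
  refine ⟨sum_fibre_mem h f _ rfl (A _) (B _) (hA _) (hB _), -(w 0 / w 1), fun q' hq' hne => ?_⟩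
  obtain ⟨f', hf'⟩ := exists_conf_of_mem h _ (A _) (B _) (hA _) (hB _) q' hq'
  have hlt := hmin f' (by rw [hf']; exact hne)
  rw [hf'] at hlt
  exact chart_of_exposed hw1 hlt

end Summit.ValiantsHypothesis.ValiantsHypothesis.Theorems.NewtonUnitEquationsNewtonTauWeak
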